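import Summits.NavierStokesRegularity.NavierStokesRegularity.Theorems.TautCompressionIntegrable.Negative.SwirlStrainProfile

/-!
# Calibration of the swirl–strain profile (negative side of `TautCompressionIntegrable`), part 3/4

Supports and sizes of the pieces of `V_δ`; the CALIBRATION `∮_γ V_δ = ∮_γ (v_sw + δ m)` with
`|v_sw + δ m| ≤ 1` (the gradient `δ∇ψ` has no circulation, `v_sw` and `m` have disjoint supports), whence
`|∮_γ V_δ| ≤ length(γ)` for every closed `C¹` loop; and the unit circle: `∮_{γ₁} V_δ = 2π`,
`⟪γ₁', DV_δ γ₁'⟫ = −δ(2π)²`. Theorems only.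
-/

noncomputable section

namespace Summit.NavierStokesRegularity.NavierStokesRegularity.Theorems.TautCompressionIntegrable.Negative

open MeasureTheory Set Filter Metric Real intervalIntegral InnerProductSpace
open scoped ENNReal RealInnerProductSpace ContDiff Topology
open Literature.Analysis.FluidPDE

set_option linter.dupNamespace false

local notation "ℝ³" => EuclideanSpace ℝ (Fin 3)

/-! ### Support and size of the swirl -/

/-- The swirl amplitude is nonnegative. -/
theorem famp_nonneg (x : ℝ³) : 0 ≤ famp x :=
  mul_nonneg (mul_nonneg (Real.exp_pos _).le (χ1.nonneg)) (β0.nonneg)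

/-- The swirl amplitude is at most `e^{(1 − ρ²)/2}`. -/
theorem famp_le (x : ℝ³) : famp x ≤ Real.exp ((1 - ρ2 x) / 2) := by
  unfold famp Fprof qmap
  have h1 : χ1 (ρ2 x) ≤ 1 := χ1.le_one
  have h2 : β0 (x 2) ≤ 1 := β0.le_one
  have h3 : 0 ≤ χ1 (ρ2 x) := χ1.nonneg
  have h4 : 0 ≤ β0 (x 2) := β0.nonneg
  have h5 : 0 < Real.exp ((1 - ρ2 x) / 2) := Real.exp_pos _
  calc Real.exp ((1 - ρ2 x) / 2) * χ1 (ρ2 x) * β0 (x 2)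
      ≤ Real.exp ((1 - ρ2 x) / 2) * 1 * 1 := by gcongr
    _ = Real.exp ((1 - ρ2 x) / 2) := by ring

/-- The key scalar inequality `e^{(1−t)/2} √t ≤ 1` (`t ≤ e^{t−1}`). -/
theorem exp_mul_sqrt_le_one (t : ℝ) : Real.exp ((1 - t) / 2) * Real.sqrt t ≤ 1 := by
  have h1 : Real.sqrt t ≤ Real.exp ((t - 1) / 2) := by
    have h2 : t ≤ Real.exp ((t - 1) / 2) * Real.exp ((t - 1) / 2) := by
      rw [← Real.exp_add, add_halves]
      linarith [Real.add_one_le_exp (t - 1)]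
    calc Real.sqrt t ≤ Real.sqrt (Real.exp ((t - 1) / 2) * Real.exp ((t - 1) / 2)) :=
          Real.sqrt_le_sqrt h2
      _ = Real.exp ((t - 1) / 2) := Real.sqrt_mul_self (Real.exp_pos _).le
  calc Real.exp ((1 - t) / 2) * Real.sqrt t ≤ Real.exp ((1 - t) / 2) * Real.exp ((t - 1) / 2) := by
        gcongr
    _ = 1 := by
        rw [← Real.exp_add, show (1 - t) / 2 + (t - 1) / 2 = 0 by ring, Real.exp_zero]

/-- `ρ² ≥ 0`. -/
theorem ρ2_nonneg (x : ℝ³) : 0 ≤ ρ2 x := by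
  unfold ρ2; nlinarith [sq_nonneg (x 0), sq_nonneg (x 1)]

/-- `‖J x‖ = √ρ²`. -/
theorem norm_Jrot_eq (x : ℝ³) : ‖Jrot x‖ = Real.sqrt (ρ2 x) := by
  rw [← Real.sqrt_sq (norm_nonneg (Jrot x)), norm_Jrot_sq]
  congr 1
  unfold ρ2; ring

/-- **`|v_sw| ≤ 1` everywhere.** -/
theorem norm_vSwirl_le (x : ℝ³) : ‖vSwirl x‖ ≤ 1 := by
  rw [vSwirl, norm_smul, Real.norm_eq_abs, abs_of_nonneg (famp_nonneg x), norm_Jrot_eq]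
  calc famp x * Real.sqrt (ρ2 x) ≤ Real.exp ((1 - ρ2 x) / 2) * Real.sqrt (ρ2 x) := by
        gcongr
        exact famp_le x
    _ ≤ 1 := exp_mul_sqrt_le_one (ρ2 x)

/-- The swirl amplitude vanishes when `ρ² ≥ 7/4` or `|x₂| ≥ 2`. -/
theorem famp_eq_zero_of {x : ℝ³} (h : 7 / 4 ≤ ρ2 x ∨ 2 ≤ |x 2|) : famp x = 0 := by
  unfold famp Fprof qmap
  rcases h with h | h
  · have : χ1 (ρ2 x) = 0 := by
      refine χ1.zero_of_le_dist ?_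
      rw [Real.dist_eq]
      show (3 : ℝ) / 4 ≤ |ρ2 x - 1|
      rw [abs_of_nonneg (by linarith)]
      linarith
    simp [this]
  · have : β0 (x 2) = 0 := by
      refine β0.zero_of_le_dist ?_
      rw [Real.dist_eq, sub_zero]
      exact h
    simp [this]

/-- The swirl is supported in the closed ball of radius `3`. -/
theorem vSwirl_eq_zero_of_norm {x : ℝ³} (hx : 3 < ‖x‖) : vSwirl x = 0 := by
  have hsq : 9 < ρ2 x + x 2 * x 2 := by
    have h9 : (9 : ℝ) < ‖x‖ ^ 2 := by nlinarith [norm_nonneg x]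
    rw [norm_sq_eq_three] at h9
    unfold ρ2; nlinarith [h9]
  have h : 7 / 4 ≤ ρ2 x ∨ 2 ≤ |x 2| := by
    by_contra hcon
    obtain ⟨hc1, hc2⟩ := not_or.1 hcon
    have hc1' := not_le.1 hc1
    have hc2' := not_le.1 hc2
    have h2 : x 2 * x 2 < 4 := by
      have hab : |x 2| * |x 2| < 2 * 2 :=
        mul_lt_mul'' hc2' hc2' (abs_nonneg _) (abs_nonneg _)
      rw [abs_mul_abs_self] at hab
      linarith
    linarith
  rw [vSwirl, famp_eq_zero_of h, zero_smul]

/-- The swirl is compactly supported. -/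
theorem hasCompactSupport_vSwirl : HasCompactSupport vSwirl :=
  HasCompactSupport.intro (isCompact_closedBall (0 : ℝ³) 3) fun x hx =>
    vSwirl_eq_zero_of_norm (by simpa using hx)

/-- On the unit circle the amplitude is `1`: `v_sw(γ₁(s)) = J γ₁(s)`. -/
theorem famp_γ₁ (s : ℝ) : famp (γ₁ s) = 1 := by
  have hρ : ρ2 (γ₁ s) = 1 := by
    unfold ρ2
    rw [γ₁_apply_zero, γ₁_apply_one]
    nlinarith [cos_sq_add_sin_sq (2 * π * s)]
  unfold famp Fprof qmap
  simp only [hρ, γ₁_apply_two, sub_self, zero_div, Real.exp_zero, one_mul]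
  rw [χ1.one_of_mem_closedBall (Metric.mem_closedBall_self χ1.rIn_pos.le),
    β0.one_of_mem_closedBall (Metric.mem_closedBall_self β0.rIn_pos.le), one_mul]

/-- On the unit circle the swirl is the unit rotation field. -/
theorem vSwirl_γ₁ (s : ℝ) : vSwirl (γ₁ s) = Jrot (γ₁ s) := by
  rw [vSwirl, famp_γ₁, one_smul]

/-! ### Support and size of the strain pieces -/

/-- The localised vector potential is compactly supported. -/
theorem hasCompactSupport_Ψloc : HasCompactSupport Ψloc :=
  χb.hasCompactSupport.mono fun x hx => by
    contrapose! hx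
    simp [Ψloc, Function.notMem_support.1 hx]

/-- The localised strain is compactly supported. -/
theorem hasCompactSupport_wStr : HasCompactSupport wStr := hasCompactSupport_curl hasCompactSupport_Ψloc

/-- The localised scalar potential is compactly supported. -/
theorem hasCompactSupport_ψpot : HasCompactSupport ψpot := χb.hasCompactSupport.mul_right

/-- Its gradient is compactly supported. -/
theorem hasCompactSupport_gradient_ψpot : HasCompactSupport (gradient ψpot) := by
  have h : gradient ψpot = (InnerProductSpace.toDual ℝ ℝ³).symm ∘ fderiv ℝ ψpot := rfl
  rw [h]
  exact (hasCompactSupport_ψpot.fderiv (𝕜 := ℝ)).comp_left (map_zero _)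

/-- Its gradient is continuous. -/
theorem continuous_gradient_ψpot : Continuous (gradient ψpot) := by
  show Continuous fun x => (InnerProductSpace.toDual ℝ ℝ³).symm (fderiv ℝ ψpot x)
  exact (InnerProductSpace.toDual ℝ ℝ³).symm.continuous.comp (contDiff_ψpot.continuous_fderiv (by simp))

/-- The residual is compactly supported. -/
theorem hasCompactSupport_mRes : HasCompactSupport mRes := by
  show HasCompactSupport (wStr - gradient ψpot)
  exact hasCompactSupport_wStr.sub hasCompactSupport_gradient_ψpot

/-- The residual is continuous. -/
theorem continuous_mRes : Continuous mRes :=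
  contDiff_wStr.continuous.sub continuous_gradient_ψpot

/-- The residual is bounded. -/
theorem exists_bound_mRes : ∃ C : ℝ, 0 ≤ C ∧ ∀ x, ‖mRes x‖ ≤ C := by
  obtain ⟨C, hC⟩ := continuous_mRes.bounded_above_of_compact_support hasCompactSupport_mRes
  exact ⟨max C 0, le_max_right _ _, fun x => (hC x).trans (le_max_left _ _)⟩

/-- The profile is compactly supported. -/
theorem hasCompactSupport_vW (δ : ℝ) : HasCompactSupport (vW δ) :=
  hasCompactSupport_vSwirl.add (hasCompactSupport_wStr.mono fun x hx => by
    contrapose! hx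
    simp [Function.notMem_support.1 hx])

/-- `‖DV_δ‖` is bounded. -/
theorem exists_bound_fderiv_vW (δ : ℝ) : ∃ L : ℝ, 0 ≤ L ∧ ∀ x, ‖fderiv ℝ (vW δ) x‖ ≤ L := by
  obtain ⟨L, hL⟩ := ((contDiff_vW δ).continuous_fderiv (by simp)).bounded_above_of_compact_support
    ((hasCompactSupport_vW δ).fderiv (𝕜 := ℝ))
  exact ⟨max L 0, le_max_right _ _, fun x => (hL x).trans (le_max_left _ _)⟩

/-! ### The calibration: every admissible loop is long -/

/-- **The calibrated field is bounded by `1`**: `|v_sw + δ m| ≤ 1` once `δ · sup|m| ≤ 1` (the two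
summands have disjoint supports). -/
theorem norm_vSwirl_add_smul_mRes_le {δ C : ℝ} (hδ : 0 ≤ δ) (hC : ∀ x, ‖mRes x‖ ≤ C)
    (hδC : δ * C ≤ 1) (x : ℝ³) : ‖vSwirl x + δ • mRes x‖ ≤ 1 := by
  by_cases hx : ‖x‖ < 4
  · rw [mRes_eq_zero hx, smul_zero, add_zero]
    exact norm_vSwirl_le x
  · rw [vSwirl_eq_zero_of_norm (by linarith [not_lt.1 hx]), zero_add, norm_smul, Real.norm_eq_abs,
      abs_of_nonneg hδ]
    exact (mul_le_mul_of_nonneg_left (hC x) hδ).trans hδC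

/-- **Circulations of `V_δ` see only the calibrated field**: `∮ V_δ = ∮ (v_sw + δ m)` (the gradient
part `δ ∇ψ` has zero circulation), hence `|∮_γ V_δ| ≤ length(γ)`. -/
theorem abs_circulation_vW_le {δ C : ℝ} (hδ : 0 ≤ δ) (hC : ∀ x, ‖mRes x‖ ≤ C) (hδC : δ * C ≤ 1)
    {γ : ℝ → ℝ³} (hγ : IsC1Loop γ) : |circulation (vW δ) γ| ≤ len γ := by
  have hsplit : vW δ = (fun x => vSwirl x + δ • mRes x) + δ • gradient ψpot := by
    funext x
    simp only [vW, mRes, Pi.add_apply, Pi.smul_apply, smul_sub]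
    abel
  have hc1 : Continuous fun x => vSwirl x + δ • mRes x :=
    contDiff_vSwirl.continuous.add (continuous_mRes.const_smul δ)
  have hc2 : Continuous (δ • gradient ψpot) := continuous_gradient_ψpot.const_smul δ
  rw [hsplit, circulation_add_left hc1 hc2 hγ.contDiff, circulation_smul_left,
    circulation_gradient_eq_zero (contDiff_ψpot.of_le (by simp)) hγ, mul_zero, add_zero]
  simpa using abs_circulation_le hc1 (norm_vSwirl_add_smul_mRes_le hδ hC hδC) hγ

/-! ### The unit circle is taut and strained -/

/-- `∮_{γ₁} V_δ = 2π`. -/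
theorem circulation_vW_γ₁ (δ : ℝ) : circulation (vW δ) γ₁ = 2 * π := by
  have hsw : circulation vSwirl γ₁ = 2 * π := by
    unfold circulation
    have : ∀ s, ⟪vSwirl (γ₁ s), deriv γ₁ s⟫ = 2 * π := fun s => by
      rw [vSwirl_γ₁, deriv_γ₁, real_inner_smul_right, real_inner_self_eq_norm_sq, norm_Jrot_γ₁]
      ring
    simp_rw [this]
    simp
  have hst : circulation wStr γ₁ = 0 := by
    unfold circulation
    have : ∀ s, ⟪wStr (γ₁ s), deriv γ₁ s⟫ = 0 := fun s => by
      rw [wStr_eq_Sst (by rw [norm_γ₁]; norm_num), deriv_γ₁, real_inner_smul_right]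
      simp only [PiLp.inner_apply, Fin.sum_univ_three, RCLike.inner_apply, conj_trivial,
        Sst_apply_zero, Sst_apply_one, Sst_apply_two, Jrot_apply_zero, Jrot_apply_one,
        Jrot_apply_two, γ₁_apply_two]
      ring
    simp_rw [this]
    simp
  rw [vW, circulation_add_left contDiff_vSwirl.continuous (contDiff_wStr.continuous.const_smul δ)
    isC1Loop_γ₁.contDiff, circulation_smul_left, hsw, hst, mul_zero, add_zero]

/-- **The strain of `V_δ` along the unit circle**: `⟪γ₁', DV_δ(γ₁) γ₁'⟫ = −δ (2π)²` (the swirl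
contributes `⟪γ₁', J γ₁'⟫ = 0`, the strain `⟪γ₁', δ S γ₁'⟫ = −δ‖γ₁'‖²`). -/
theorem inner_fderiv_vW_γ₁ (δ : ℝ) (s : ℝ) :
    ⟪deriv γ₁ s, fderiv ℝ (vW δ) (γ₁ s) (deriv γ₁ s)⟫ = -δ * (2 * π) ^ 2 := by
  have hd1 : DifferentiableAt ℝ vSwirl (γ₁ s) := (contDiff_vSwirl.differentiable (by simp)) _
  have hd2 : DifferentiableAt ℝ wStr (γ₁ s) := (contDiff_wStr.differentiable (by simp)) _
  have hγd : DifferentiableAt ℝ γ₁ s := isC1Loop_γ₁.differentiable s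
  have hsw : fderiv ℝ vSwirl (γ₁ s) (deriv γ₁ s) = Jrot (deriv γ₁ s) := by
    rw [← fderiv_comp_deriv s hd1 hγd]
    have : vSwirl ∘ γ₁ = ⇑Jrot ∘ γ₁ := funext fun s => vSwirl_γ₁ s
    rw [this, fderiv_comp_deriv s Jrot.differentiableAt hγd, ContinuousLinearMap.fderiv]
  have hst : fderiv ℝ wStr (γ₁ s) = Sst := fderiv_wStr (by rw [norm_γ₁]; norm_num)
  rw [vW, fderiv_add hd1 (hd2.const_smul δ), fderiv_const_smul hd2]
  simp only [add_apply, FunLike.coe_smul, Pi.smul_apply, hsw, hst, Sst_deriv_γ₁,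
    inner_add_right, real_inner_smul_right, inner_neg_right, inner_Jrot_self,
    real_inner_self_eq_norm_sq, norm_deriv_γ₁]
  ring

end Summit.NavierStokesRegularity.NavierStokesRegularity.Theorems.TautCompressionIntegrable.Negative

end
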